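import Literature.AlgebraicGeometry.HodgeTheory.CyclicCoverLinearPencil
import Literature.AlgebraicGeometry.HodgeTheory.MonodromyGroupBaseChange
import Literature.AlgebraicGeometry.FundamentalGroup.HypersurfaceComplementZariskiPencils
import HarnessLib

/-!
# Every loop of the Carlson–Toledo base lifts, up to homotopy, to a transversal pencil (Zariski's theorem
# for the pencils `x₃^p = f₀ + u·g` of cyclic covers of the plane)

Family `hodge`, layer `Literature/AlgebraicGeometry/HodgeTheory`, namespace `…HodgeTheory.LinearPencil`; theorems
only, no named fact. Written by the prover seat `hodge-nonav-prover-Ax` (g14) for route `CyclicUnitaryPowers`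
(crux K1, stmt-HodgeConjecture-19544), programme ZARISKI.

For the pencil `ι = pencilMap p f₀ g : P ⟶ S` (file `CyclicCoverLinearPencil`) and a point `c₀ ∈ P(ℂ)` such that
the pointed line `(f₀ + u₀ g, g)` (`u₀ = pencilCoord c₀`) satisfies `pencilDiscr D ≠ 0` for an equation `D` of
the discriminant of the cyclic family (`CyclicCoverBaseChart.exists_irreducible_discriminantEquation`), EVERY loop
of `S(ℂ)` at `ι c₀` is homotopic with fixed base point to the image under `ι` of a loop of `P(ℂ)` at `c₀`
(`exists_loop_lift_pencilMap`): Zariski's theorem `HypersurfaceComplementZariskiPencils.exists_loop_in_line_of_pencilDiscr`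
read through the coefficient chart `χ : S(ℂ) ≃ₜ ℂ^{N+1} ∖ Δ̃` (`exists_homeomorph_affineHypersurfaceComplement`) and the
chart `pencilChart : P(ℂ) ≃ₜ {u | x₃^p − f_u nonsingular}`.  This is exactly the hypothesis of
`MonodromyGroupBaseChange.exists_finiteIndex_conj_mem_ratMonodromyGroup_familyPullback`, whence the
large-monodromy hypothesis (HL) of the curve theorem for the pencil (`exists_finiteIndex_pencilMap`).

## References

* [Dimca1992] A. Dimca, *Singularities and Topology of Hypersurfaces* (1992), Ch. 4 §3 Prop. (3.1).
* [CarlsonToledo1999] J. A. Carlson, D. Toledo, Duke Math. J. 97 (1999), §2–§3 (held text p0004–p0007: `Ũ`,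
  `π₁(Ũ)` and pencils).
* [VoisinHodgeII2003] C. Voisin, *Hodge Theory and Complex Algebraic Geometry II*, §3.1.2, §3.2.2 Thm. 3.22.
* [HatcherAT2002] A. Hatcher, *Algebraic Topology*, §1.1 (change of base point, induced maps).
-/

noncomputable section

namespace Literature.AlgebraicGeometry.HodgeTheory

open CategoryTheory MvPolynomial _root_.Topology Set unitInterval
open Literature.AlgebraicGeometry.Motives Literature.AlgebraicGeometry.Motives.UniversalHypersurface
open Literature.AlgebraicGeometry.Motives.SmoothHypersurface (IsNonsingularForm)
open Literature.AlgebraicGeometry.HodgeTheory.UniversalHypersurface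
open Literature.AlgebraicGeometry.FundamentalGroup Literature.AlgebraicTopology.FundamentalGroup

namespace LinearPencil

/-! ### A transport lemma for path classes -/

/-- **Transport of an equality of loop classes along a continuous map with prescribed pointwise images**:
if `⟦p⟧ = ⟦q⟧` in `Y` and the loops `a`, `b` of `X` are pointwise `Ψ ∘ p`, `Ψ ∘ q`, then `⟦a⟧ = ⟦b⟧`
(`a = (Ψ ∘ p).cast`, `b = (Ψ ∘ q).cast`). [cite: HatcherAT2002, §1.1 (induced homomorphisms)] -/
theorem mk_eq_mk_of_comp {X Y : Type*} [TopologicalSpace X] [TopologicalSpace Y] (Ψ : C(Y, X)) {y : Y}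
    {p q : Path y y} (hpq : Path.Homotopic.Quotient.mk p = Path.Homotopic.Quotient.mk q) {x : X} (a b : Path x x)
    (ha : ∀ t, a t = Ψ (p t)) (hb : ∀ t, b t = Ψ (q t)) :
    Path.Homotopic.Quotient.mk a = Path.Homotopic.Quotient.mk b := by
  have hx : x = Ψ y := by rw [← p.source, ← ha 0, a.source]
  have ha' : a = (p.map Ψ.continuous).cast hx hx := by
    ext t; rw [Path.cast_coe, Path.map_coe, Function.comp_apply, ha]
  have hb' : b = (q.map Ψ.continuous).cast hx hx := by
    ext t; rw [Path.cast_coe, Path.map_coe, Function.comp_apply, hb]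
  rw [ha', hb', Path.Homotopic.Quotient.mk_cast, Path.Homotopic.Quotient.mk_cast, Path.Homotopic.Quotient.mk_map,
    Path.Homotopic.Quotient.mk_map, hpq]

/-! ### Loops of `S(ℂ)` lift to transversal pencils -/

section Lift

variable {p : ℕ} [NeZero p] {f₀ g : TernaryIndex p → ℂ}

/-- **Every loop of the Carlson–Toledo base at a point of a transversal pencil is homotopic to a loop in the
pencil.**  Let `D` be an equation of the discriminant (`D(b) = 0 ↔ x₃^p − f_b singular`), `g ≠ 0`,
`c₀ ∈ P(ℂ)` a point of the pencil base with coordinate `u₀`, and suppose `pencilDiscr D (f₀ + u₀ g, g) ≠ 0`.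
Then every loop `γ` of `S(ℂ)` at `ι c₀` satisfies `⟦γ⟧ = ⟦ι ∘ δ⟧` for a loop `δ` of `P(ℂ)` at `c₀`
(Zariski's theorem in the chart `χ : S(ℂ) ≃ₜ ℂ^{N+1} ∖ Δ̃`, lifted through `pencilChart`).
[cite: Dimca1992, Ch. 4 §3 Prop. (3.1)] [cite: CarlsonToledo1999, §2–§3 (held text p0004–p0007)] -/
theorem exists_loop_lift_pencilMap {D : MvPolynomial (TernaryIndex p) ℂ}
    (hD : ∀ b : TernaryIndex p → ℂ, MvPolynomial.eval b D = 0 ↔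
      ¬ IsNonsingularForm ℂ (cyclicCoverForm p (∑ e : TernaryIndex p, monomial e.1 (b e))))
    (hg : g ≠ 0) (c₀ : ComplexPoints (pencilBase p f₀ g))
    (hQ : MvPolynomial.eval (Sum.elim (f₀ + pencilCoord p f₀ g c₀ • g) g) (pencilDiscr D) ≠ 0)
    (γ : Path (baseMapUniv (pencilMap p f₀ g) ⟨c₀, mem_univ _⟩) (baseMapUniv (pencilMap p f₀ g) ⟨c₀, mem_univ _⟩)) :
    ∃ δ : Path (⟨c₀, mem_univ _⟩ : (univ : Set (ComplexPoints (pencilBase p f₀ g)))) ⟨c₀, mem_univ _⟩,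
      Path.Homotopic.Quotient.mk γ =
        Path.Homotopic.Quotient.mk (δ.map (baseMapUniv (pencilMap p f₀ g)).continuous) := by
  obtain ⟨χ, hχ⟩ := exists_homeomorph_affineHypersurfaceComplement (p := p) hD
  set u₀ : ℂ := pencilCoord p f₀ g c₀ with hu₀
  set b : TernaryIndex p → ℂ := f₀ + u₀ • g with hbdef
  have hbe : ∀ e, b e = f₀ e + u₀ * g e := fun e => rfl
  have hbU : b ∈ affineHypersurfaceComplement ![D] := mem_affineHypersurfaceComplement_of_pencilDiscr hQ
  -- the base point in the chart
  have hχc₀ : χ (AlgPoints.map (pencilMap p f₀ g) c₀) = ⟨b, hbU⟩ :=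
    Subtype.ext (funext fun e => by rw [hχ, coeff_branchForm_map_pencilMap]; exact (hbe e).symm)
  -- the chart maps between `S(ℂ)` (as `univ`) and `ℂ^{N+1} ∖ Δ̃`
  let Φ : C((univ : Set (ComplexPoints (cyclicCoverBase p))), affineHypersurfaceComplement ![D]) :=
    ⟨fun x => χ x.1, χ.continuous.comp continuous_subtype_val⟩
  let Ψ : C(affineHypersurfaceComplement ![D], (univ : Set (ComplexPoints (cyclicCoverBase p)))) :=
    ⟨fun a => ⟨χ.symm a, mem_univ _⟩, χ.symm.continuous.subtype_mk _⟩
  have hΦ0 : Φ (baseMapUniv (pencilMap p f₀ g) ⟨c₀, mem_univ _⟩) = ⟨b, hbU⟩ := hχc₀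
  -- Zariski's theorem for the loop read in the chart
  let γ₁ : Path (⟨b, hbU⟩ : affineHypersurfaceComplement ![D]) ⟨b, hbU⟩ := (γ.map Φ.continuous).cast hΦ0.symm hΦ0.symm
  obtain ⟨ω, hω⟩ := exists_loop_in_line_of_pencilDiscr hbU hQ γ₁
  -- the parameters `u₀ + ω(t)` are nonsingular
  have hωU : ∀ t, MvPolynomial.eval (b + (ω t : ℂ) • g) D ≠ 0 := fun t =>
    (mem_lineSlice_add_iff (h := D) b g (ω t : ℂ)).1 (ω t).2
  have hns : ∀ t, IsNonsingularForm ℂ (cyclicCoverForm p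
      (∑ e : TernaryIndex p, monomial e.1 (f₀ e + (u₀ + (ω t : ℂ)) * g e))) := by
    intro t
    have h1 := hωU t
    have heq : (b + (ω t : ℂ) • g) = fun e => f₀ e + (u₀ + (ω t : ℂ)) * g e := by
      funext e
      simp only [Pi.add_apply, Pi.smul_apply, smul_eq_mul, hbe]
      ring
    rw [heq] at h1
    by_contra hc
    exact h1 ((hD _).2 hc)
  -- the lifted loop
  let w : I → {u : ℂ | IsNonsingularForm ℂ (cyclicCoverForm p (∑ e : TernaryIndex p, monomial e.1 (f₀ e + u * g e)))} :=
    fun t => ⟨u₀ + (ω t : ℂ), hns t⟩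
  have hw : Continuous w :=
    (continuous_const.add (continuous_subtype_val.comp ω.continuous)).subtype_mk _
  have hω0 : (ω 0 : ℂ) = 0 := congrArg Subtype.val ω.source
  have hω1 : (ω 1 : ℂ) = 0 := congrArg Subtype.val ω.target
  have hchart : pencilChart p f₀ hg c₀ = ⟨u₀, by simpa using hns 0⟩ := Subtype.ext (pencilChart_apply_coe p f₀ hg c₀)
  have hend : ∀ {t}, (ω t : ℂ) = 0 → (pencilChart p f₀ hg).symm (w t) = c₀ := by
    intro t ht
    have : w t = pencilChart p f₀ hg c₀ := by
      rw [hchart]; exact Subtype.ext (by change u₀ + (ω t : ℂ) = u₀; rw [ht, add_zero])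
    rw [this, Homeomorph.symm_apply_apply]
  let δ : Path (⟨c₀, mem_univ _⟩ : (univ : Set (ComplexPoints (pencilBase p f₀ g)))) ⟨c₀, mem_univ _⟩ :=
    { toFun := fun t => ⟨(pencilChart p f₀ hg).symm (w t), mem_univ _⟩
      continuous_toFun := ((pencilChart p f₀ hg).symm.continuous.comp hw).subtype_mk _
      source' := Subtype.ext (hend hω0)
      target' := Subtype.ext (hend hω1) }
  refine ⟨δ, mk_eq_mk_of_comp Ψ hω γ _ (fun t => Subtype.ext ?_) (fun t => Subtype.ext ?_)⟩
  · -- `γ t = χ⁻¹ (χ (γ t))`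
    change (γ t).1 = χ.symm (γ₁ t)
    rw [Path.cast_coe, Path.map_coe, Function.comp_apply]
    change (γ t).1 = χ.symm (χ (γ t).1)
    rw [Homeomorph.symm_apply_apply]
  · -- `ι (δ t) = χ⁻¹ (b + ω(t) g)`
    change AlgPoints.map (pencilMap p f₀ g) ((pencilChart p f₀ hg).symm (w t)) =
      χ.symm (((ω.map (LineSlice.lineIncl (affineHypersurfaceComplement ![D]) b (b + g)).continuous).cast
        (LineSlice.lineIncl_zero hbU (b + g)).symm (LineSlice.lineIncl_zero hbU (b + g)).symm) t)
    apply χ.injective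
    rw [Homeomorph.apply_symm_apply, Path.cast_coe, Path.map_coe, Function.comp_apply]
    refine Subtype.ext (funext fun e => ?_)
    rw [hχ, coeff_branchForm_map_pencilMap_symm, LineSlice.coe_lineIncl_apply, LineSlice.linePt]
    simp only [Pi.add_apply, Pi.smul_apply, smul_eq_mul, add_sub_cancel_left, hbe]
    change f₀ e + (u₀ + (ω t : ℂ)) * g e = f₀ e + u₀ * g e + (ω t : ℂ) * g e
    ring

end Lift

end LinearPencil

end Literature.AlgebraicGeometry.HodgeTheory

end
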